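import Summits.QuantumFields.BalabanUV.Beta.GAN24.WilsonQuarticCharge
import Summits.QuantumFields.BalabanUV.Beta.GAN24.WilsonBiStencilCornerSupport

/-!
# `BalabanUV.Beta.GAN24.WilsonQuarticChargeWsym22Frames` — binder row G-an2-4 ∕ (CONV-C), W-slot CT-route, (C)_0 ∕ (C)sym level-0 kernel programme
# ((I)+(II)+(III) comparison, leaf-02's register), Part 1 of 2: **THE SIXTEEN RELATIVE PLAQUETTE FRAMES OF an3's SYMMETRISED TRACED WILSON TABLE `wsym22 N`**
# (frame `(μ,ν)`, `μ ≠ ν`, pattern letters among `μ, ν`), the degenerate frames, and the frames missing a pattern direction — the inputs of the all-pattern charge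
# tensor `WilsonQuarticChargeWsym22.tsum_wilsonW₂_wsym22_ff`

NOT IN PRINT; OUR BOOKKEEPING (G-an2-4 crux team (2), leaf prover `b2b-balaban-gan24-formalise-leaf-02`, gen 63; journal INTENT I-leaf02-g63-1).  HONEST FRAMING
(cell contract, verbatim): «discharging `BetaPertH` makes Bałaban's UV stability UNCONDITIONAL — a real constructive-QFT result; it is NOT the continuum limit and NOT
the Clay problem.»  HONEST DEPENDENCY (verbatim): «continuum YM on T⁴ ⇐ BetaPertH ∧ nine spine estimates (0/9 proved); BetaPertH ⇐ (D1) ∧ (D4) ∧ CAP+tail; G-an2-4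
gates asym, D1 and NE2/3/4.»  [folklore] finite plaquette-frame algebra over an3's DEFINED objects (`WilsonVertex2Sym.wsym22 ∕ chi`, `PlaquetteVertex2Stencil.dir`,
`PlaquetteVertex2Coords.sgn`, `PlaquetteVertex2Polar.inc`) in the currency of leaf-18 g16's frame functional `WilsonQuarticCharge.tsum_wilsonW₂_ff_eq` (`dir_eq_or` BY NAME; `dir_self` from my g62 `WilsonBiStencilCornerSupport`);
generic `d`; 0 `def`, 0 cited facts, 0 `def … : Prop`, 0 sorry.  Discharges NOTHING of (C) ∕ (C)sym ∕ (Q-L) ∕ «T2Shape» ∕ «T2Drift» ∕ (hW, hWall); NEVER «G-an2-4 closed» as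
(CONV-C); NOT D1, NOT BetaPertH, NOT continuum, NOT Clay.

## What
The FRAME SUM of a position table `T` at the plaquette frame `(μ,ν)` for the direction pattern `(κ,κ′;α,β)` is leaf-18's inner functional
`Σ_{k,l} [dir μ ν k = κ ∧ dir μ ν l = κ′] · Σ_{i,j} [α = dir μ ν i ∧ β = dir μ ν j] · T i j k l` (positions `0,1,2,3` of `p_{μν}(x)` point along `μ, ν, μ, ν`).
* §1 `dir_apply_zero … three` (position → direction; the degenerate cell is my g62 `WilsonBiStencilCornerSupport.dir_self` BY NAME).
* §2 THE SIXTEEN RELATIVE FRAMES `frame_wsym22_<κκ′αβ>` (letters `m ∕ n` for `μ ∕ ν`; `μ ≠ ν`): `−4N²` on `(m,m;n,n)` and `(n,n;m,m)` (both fluctuation letters on one axis,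
  both background letters on the other), `+2N²` on `(m,n;m,n)`, `(n,m;n,m)`, `(m,n;n,m)`, `(n,m;m,n)` (one letter of each kind on each axis), `0` on the other ten — the
  `(N²−1)`-part of `wsym22 = s⊗⁴·((N²−1) − N²·chi)` dies frame by frame since `s₀ + s₂ = s₁ + s₃ = 0`, the `chi`-part is a signed interleaving count (each lemma: `simp`
  decides the sixteen position conditions from `μ ≠ ν`, then evaluates ≤ 16 table entries; exact-rational cross-check of all sixteen values and of the assembled tensor at
  `d = 1, 2, 3`: `HOME/b2b-balaban-gan24-formalise-leaf-02/g63/py/z4_wsym22.py`, 0 mismatches).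
* §3 `sum4_wsym22_eq_zero` (the full position sum of `wsym22 N` vanishes), `frame_wsym22_diag` (a DEGENERATE frame `μ = ν` carries no charge, every pattern),
  `frame_eq_zero_of_not_mem` (generic `T`: a frame not containing all four pattern directions carries no charge — leaf-18's `(κ,κ;α,α)` lemma for every pattern).
Part 2 (`WilsonQuarticChargeWsym22`) sums the frames: `Σ'_{u′xz} wilsonW₂ d (wsym22 N) κ u κ′ u′ x z (inl α) (inl β) = −4N²·(2[κ=κ′][α=β] − [κ=β][κ′=α] − [κ=α][κ′=β])`.
2026-08-23; no existing file touched.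
-/

noncomputable section

open Finset
open scoped BigOperators
open Literature.MathematicalPhysics.QuantumFieldTheory
open Literature.MathematicalPhysics.QuantumFieldTheory.Balaban1983to89
open Literature.MathematicalPhysics.QuantumFieldTheory.Balaban1983to89.Beta
open PlaquetteVertex2Stencil (dir)
open PlaquetteVertex2Coords (sgn)
open PlaquetteVertex2Polar (inc)
open WilsonVertex2Sym (wsym22 chi)
open Summit.QuantumFields.BalabanUV.Beta.GAN24.WilsonQuarticCharge (dir_eq_or)
open Summit.QuantumFields.BalabanUV.Beta.GAN24.WilsonBiStencilCornerSupport (dir_self)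

namespace Summit.QuantumFields.BalabanUV.Beta.GAN24.WilsonQuarticChargeWsym22Frames

variable {d : ℕ}

/-! ## §1 Positions and directions on the plaquette path -/

/-- [folklore] position `0` of `p_{μν}` points along `μ`. -/
theorem dir_apply_zero (μ ν : Fin (d + 1)) : dir μ ν 0 = μ := rfl

/-- [folklore] position `1` of `p_{μν}` points along `ν`. -/
theorem dir_apply_one (μ ν : Fin (d + 1)) : dir μ ν 1 = ν := rfl

/-- [folklore] position `2` of `p_{μν}` points along `μ`. -/
theorem dir_apply_two (μ ν : Fin (d + 1)) : dir μ ν 2 = μ := rfl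

/-- [folklore] position `3` of `p_{μν}` points along `ν`. -/
theorem dir_apply_three (μ ν : Fin (d + 1)) : dir μ ν 3 = ν := rfl

/-! ## §2 The sixteen relative frames of `wsym22 N` (frame `(μ,ν)`, `μ ≠ ν`, pattern letters among `μ, ν`) -/

/-- [folklore] frame `(μ,ν)`, `μ ≠ ν`, relative pattern `(κ,κ′;α,β) = (μ,μ;μ,μ)`: value `0`. -/
theorem frame_wsym22_mmmm (N : ℕ) {μ ν : Fin (d + 1)} (hμν : μ ≠ ν) :
    (∑ k : Fin 4, ∑ l : Fin 4, if dir μ ν k = μ ∧ dir μ ν l = μ then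
        ∑ i : Fin 4, ∑ j : Fin 4, (if μ = dir μ ν i ∧ μ = dir μ ν j then wsym22 N i j k l else 0) else 0) = 0 := by
  simp only [Fin.sum_univ_four, dir_apply_zero, dir_apply_one, dir_apply_two, dir_apply_three, hμν, hμν.symm,
    and_true, and_false, if_true, if_false, add_zero]
  simp [wsym22, sgn, chi, inc]

/-- [folklore] frame `(μ,ν)`, `μ ≠ ν`, relative pattern `(κ,κ′;α,β) = (μ,μ;μ,ν)`: value `0`. -/
theorem frame_wsym22_mmmn (N : ℕ) {μ ν : Fin (d + 1)} (hμν : μ ≠ ν) :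
    (∑ k : Fin 4, ∑ l : Fin 4, if dir μ ν k = μ ∧ dir μ ν l = μ then
        ∑ i : Fin 4, ∑ j : Fin 4, (if μ = dir μ ν i ∧ ν = dir μ ν j then wsym22 N i j k l else 0) else 0) = 0 := by
  simp only [Fin.sum_univ_four, dir_apply_zero, dir_apply_one, dir_apply_two, dir_apply_three, hμν, hμν.symm,
    and_true, and_false, if_true, if_false, add_zero]
  simp [wsym22, sgn, chi, inc]
  ring

/-- [folklore] frame `(μ,ν)`, `μ ≠ ν`, relative pattern `(κ,κ′;α,β) = (μ,μ;ν,μ)`: value `0`. -/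
theorem frame_wsym22_mmnm (N : ℕ) {μ ν : Fin (d + 1)} (hμν : μ ≠ ν) :
    (∑ k : Fin 4, ∑ l : Fin 4, if dir μ ν k = μ ∧ dir μ ν l = μ then
        ∑ i : Fin 4, ∑ j : Fin 4, (if ν = dir μ ν i ∧ μ = dir μ ν j then wsym22 N i j k l else 0) else 0) = 0 := by
  simp only [Fin.sum_univ_four, dir_apply_zero, dir_apply_one, dir_apply_two, dir_apply_three, hμν, hμν.symm,
    and_true, and_false, if_true, if_false, add_zero]
  simp [wsym22, sgn, chi, inc]

/-- [folklore] frame `(μ,ν)`, `μ ≠ ν`, relative pattern `(κ,κ′;α,β) = (μ,μ;ν,ν)`: value `-4 * N²`. -/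
theorem frame_wsym22_mmnn (N : ℕ) {μ ν : Fin (d + 1)} (hμν : μ ≠ ν) :
    (∑ k : Fin 4, ∑ l : Fin 4, if dir μ ν k = μ ∧ dir μ ν l = μ then
        ∑ i : Fin 4, ∑ j : Fin 4, (if ν = dir μ ν i ∧ ν = dir μ ν j then wsym22 N i j k l else 0) else 0) = -4 * (N : ℝ) ^ 2 := by
  simp only [Fin.sum_univ_four, dir_apply_zero, dir_apply_one, dir_apply_two, dir_apply_three, hμν.symm,
    and_true, and_false, if_true, if_false, add_zero]
  simp [wsym22, sgn, chi, inc]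
  ring

/-- [folklore] frame `(μ,ν)`, `μ ≠ ν`, relative pattern `(κ,κ′;α,β) = (μ,ν;μ,μ)`: value `0`. -/
theorem frame_wsym22_mnmm (N : ℕ) {μ ν : Fin (d + 1)} (hμν : μ ≠ ν) :
    (∑ k : Fin 4, ∑ l : Fin 4, if dir μ ν k = μ ∧ dir μ ν l = ν then
        ∑ i : Fin 4, ∑ j : Fin 4, (if μ = dir μ ν i ∧ μ = dir μ ν j then wsym22 N i j k l else 0) else 0) = 0 := by
  simp only [Fin.sum_univ_four, dir_apply_zero, dir_apply_one, dir_apply_two, dir_apply_three, hμν, hμν.symm,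
    and_true, and_false, if_true, if_false, add_zero]
  simp [wsym22, sgn, chi, inc]
  ring

/-- [folklore] frame `(μ,ν)`, `μ ≠ ν`, relative pattern `(κ,κ′;α,β) = (μ,ν;μ,ν)`: value `2 * N²`. -/
theorem frame_wsym22_mnmn (N : ℕ) {μ ν : Fin (d + 1)} (hμν : μ ≠ ν) :
    (∑ k : Fin 4, ∑ l : Fin 4, if dir μ ν k = μ ∧ dir μ ν l = ν then
        ∑ i : Fin 4, ∑ j : Fin 4, (if μ = dir μ ν i ∧ ν = dir μ ν j then wsym22 N i j k l else 0) else 0) = 2 * (N : ℝ) ^ 2 := by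
  simp only [Fin.sum_univ_four, dir_apply_zero, dir_apply_one, dir_apply_two, dir_apply_three, hμν, hμν.symm,
    and_true, and_false, if_true, if_false, add_zero]
  simp [wsym22, sgn, chi, inc]
  ring

/-- [folklore] frame `(μ,ν)`, `μ ≠ ν`, relative pattern `(κ,κ′;α,β) = (μ,ν;ν,μ)`: value `2 * N²`. -/
theorem frame_wsym22_mnnm (N : ℕ) {μ ν : Fin (d + 1)} (hμν : μ ≠ ν) :
    (∑ k : Fin 4, ∑ l : Fin 4, if dir μ ν k = μ ∧ dir μ ν l = ν then
        ∑ i : Fin 4, ∑ j : Fin 4, (if ν = dir μ ν i ∧ μ = dir μ ν j then wsym22 N i j k l else 0) else 0) = 2 * (N : ℝ) ^ 2 := by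
  simp only [Fin.sum_univ_four, dir_apply_zero, dir_apply_one, dir_apply_two, dir_apply_three, hμν, hμν.symm,
    and_true, and_false, if_true, if_false, add_zero]
  simp [wsym22, sgn, chi, inc]
  ring

/-- [folklore] frame `(μ,ν)`, `μ ≠ ν`, relative pattern `(κ,κ′;α,β) = (μ,ν;ν,ν)`: value `0`. -/
theorem frame_wsym22_mnnn (N : ℕ) {μ ν : Fin (d + 1)} (hμν : μ ≠ ν) :
    (∑ k : Fin 4, ∑ l : Fin 4, if dir μ ν k = μ ∧ dir μ ν l = ν then
        ∑ i : Fin 4, ∑ j : Fin 4, (if ν = dir μ ν i ∧ ν = dir μ ν j then wsym22 N i j k l else 0) else 0) = 0 := by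
  simp only [Fin.sum_univ_four, dir_apply_zero, dir_apply_one, dir_apply_two, dir_apply_three, hμν, hμν.symm,
    and_true, and_false, if_true, if_false, add_zero]
  simp [wsym22, sgn, chi, inc]
  ring

/-- [folklore] frame `(μ,ν)`, `μ ≠ ν`, relative pattern `(κ,κ′;α,β) = (ν,μ;μ,μ)`: value `0`. -/
theorem frame_wsym22_nmmm (N : ℕ) {μ ν : Fin (d + 1)} (hμν : μ ≠ ν) :
    (∑ k : Fin 4, ∑ l : Fin 4, if dir μ ν k = ν ∧ dir μ ν l = μ then
        ∑ i : Fin 4, ∑ j : Fin 4, (if μ = dir μ ν i ∧ μ = dir μ ν j then wsym22 N i j k l else 0) else 0) = 0 := by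
  simp only [Fin.sum_univ_four, dir_apply_zero, dir_apply_one, dir_apply_two, dir_apply_three, hμν, hμν.symm,
    and_true, and_false, if_true, if_false, add_zero]
  simp [wsym22, sgn, chi, inc]
  ring

/-- [folklore] frame `(μ,ν)`, `μ ≠ ν`, relative pattern `(κ,κ′;α,β) = (ν,μ;μ,ν)`: value `2 * N²`. -/
theorem frame_wsym22_nmmn (N : ℕ) {μ ν : Fin (d + 1)} (hμν : μ ≠ ν) :
    (∑ k : Fin 4, ∑ l : Fin 4, if dir μ ν k = ν ∧ dir μ ν l = μ then
        ∑ i : Fin 4, ∑ j : Fin 4, (if μ = dir μ ν i ∧ ν = dir μ ν j then wsym22 N i j k l else 0) else 0) = 2 * (N : ℝ) ^ 2 := by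
  simp only [Fin.sum_univ_four, dir_apply_zero, dir_apply_one, dir_apply_two, dir_apply_three, hμν, hμν.symm,
    and_true, and_false, if_true, if_false, add_zero]
  simp [wsym22, sgn, chi, inc]
  ring

/-- [folklore] frame `(μ,ν)`, `μ ≠ ν`, relative pattern `(κ,κ′;α,β) = (ν,μ;ν,μ)`: value `2 * N²`. -/
theorem frame_wsym22_nmnm (N : ℕ) {μ ν : Fin (d + 1)} (hμν : μ ≠ ν) :
    (∑ k : Fin 4, ∑ l : Fin 4, if dir μ ν k = ν ∧ dir μ ν l = μ then
        ∑ i : Fin 4, ∑ j : Fin 4, (if ν = dir μ ν i ∧ μ = dir μ ν j then wsym22 N i j k l else 0) else 0) = 2 * (N : ℝ) ^ 2 := by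
  simp only [Fin.sum_univ_four, dir_apply_zero, dir_apply_one, dir_apply_two, dir_apply_three, hμν, hμν.symm,
    and_true, and_false, if_true, if_false, add_zero]
  simp [wsym22, sgn, chi, inc]
  ring

/-- [folklore] frame `(μ,ν)`, `μ ≠ ν`, relative pattern `(κ,κ′;α,β) = (ν,μ;ν,ν)`: value `0`. -/
theorem frame_wsym22_nmnn (N : ℕ) {μ ν : Fin (d + 1)} (hμν : μ ≠ ν) :
    (∑ k : Fin 4, ∑ l : Fin 4, if dir μ ν k = ν ∧ dir μ ν l = μ then
        ∑ i : Fin 4, ∑ j : Fin 4, (if ν = dir μ ν i ∧ ν = dir μ ν j then wsym22 N i j k l else 0) else 0) = 0 := by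
  simp only [Fin.sum_univ_four, dir_apply_zero, dir_apply_one, dir_apply_two, dir_apply_three, hμν, hμν.symm,
    and_true, and_false, if_true, if_false, add_zero]
  simp [wsym22, sgn, chi, inc]
  ring

/-- [folklore] frame `(μ,ν)`, `μ ≠ ν`, relative pattern `(κ,κ′;α,β) = (ν,ν;μ,μ)`: value `-4 * N²`. -/
theorem frame_wsym22_nnmm (N : ℕ) {μ ν : Fin (d + 1)} (hμν : μ ≠ ν) :
    (∑ k : Fin 4, ∑ l : Fin 4, if dir μ ν k = ν ∧ dir μ ν l = ν then
        ∑ i : Fin 4, ∑ j : Fin 4, (if μ = dir μ ν i ∧ μ = dir μ ν j then wsym22 N i j k l else 0) else 0) = -4 * (N : ℝ) ^ 2 := by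
  simp only [Fin.sum_univ_four, dir_apply_zero, dir_apply_one, dir_apply_two, dir_apply_three, hμν,
    and_true, and_false, if_true, if_false, add_zero]
  simp [wsym22, sgn, chi, inc]
  ring

/-- [folklore] frame `(μ,ν)`, `μ ≠ ν`, relative pattern `(κ,κ′;α,β) = (ν,ν;μ,ν)`: value `0`. -/
theorem frame_wsym22_nnmn (N : ℕ) {μ ν : Fin (d + 1)} (hμν : μ ≠ ν) :
    (∑ k : Fin 4, ∑ l : Fin 4, if dir μ ν k = ν ∧ dir μ ν l = ν then
        ∑ i : Fin 4, ∑ j : Fin 4, (if μ = dir μ ν i ∧ ν = dir μ ν j then wsym22 N i j k l else 0) else 0) = 0 := by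
  simp only [Fin.sum_univ_four, dir_apply_zero, dir_apply_one, dir_apply_two, dir_apply_three, hμν, hμν.symm,
    and_true, and_false, if_true, if_false, add_zero]
  simp [wsym22, sgn, chi, inc]

/-- [folklore] frame `(μ,ν)`, `μ ≠ ν`, relative pattern `(κ,κ′;α,β) = (ν,ν;ν,μ)`: value `0`. -/
theorem frame_wsym22_nnnm (N : ℕ) {μ ν : Fin (d + 1)} (hμν : μ ≠ ν) :
    (∑ k : Fin 4, ∑ l : Fin 4, if dir μ ν k = ν ∧ dir μ ν l = ν then
        ∑ i : Fin 4, ∑ j : Fin 4, (if ν = dir μ ν i ∧ μ = dir μ ν j then wsym22 N i j k l else 0) else 0) = 0 := by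
  simp only [Fin.sum_univ_four, dir_apply_zero, dir_apply_one, dir_apply_two, dir_apply_three, hμν, hμν.symm,
    and_true, and_false, if_true, if_false, add_zero]
  simp [wsym22, sgn, chi, inc]
  ring

/-- [folklore] frame `(μ,ν)`, `μ ≠ ν`, relative pattern `(κ,κ′;α,β) = (ν,ν;ν,ν)`: value `0`. -/
theorem frame_wsym22_nnnn (N : ℕ) {μ ν : Fin (d + 1)} (hμν : μ ≠ ν) :
    (∑ k : Fin 4, ∑ l : Fin 4, if dir μ ν k = ν ∧ dir μ ν l = ν then
        ∑ i : Fin 4, ∑ j : Fin 4, (if ν = dir μ ν i ∧ ν = dir μ ν j then wsym22 N i j k l else 0) else 0) = 0 := by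
  simp only [Fin.sum_univ_four, dir_apply_zero, dir_apply_one, dir_apply_two, dir_apply_three, hμν, hμν.symm,
    and_true, and_false, if_true, if_false, add_zero]
  simp [wsym22, sgn, chi, inc]

/-! ## §3 Degenerate frames and frames missing a pattern direction carry no charge -/

/-- [folklore] the full position sum of `wsym22 N` vanishes. -/
theorem sum4_wsym22_eq_zero (N : ℕ) : ∑ k : Fin 4, ∑ l : Fin 4, ∑ i : Fin 4, ∑ j : Fin 4, wsym22 N i j k l = 0 := by
  simp [Fin.sum_univ_four, wsym22, sgn, chi, inc]
  ring

/-- [folklore] a DEGENERATE frame `μ = ν` carries no charge, for every pattern. -/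
theorem frame_wsym22_diag (N : ℕ) (μ κ κ' α β : Fin (d + 1)) :
    (∑ k : Fin 4, ∑ l : Fin 4, if dir μ μ k = κ ∧ dir μ μ l = κ' then
        ∑ i : Fin 4, ∑ j : Fin 4, (if α = dir μ μ i ∧ β = dir μ μ j then wsym22 N i j k l else 0) else 0) = 0 := by
  simp only [dir_self]
  by_cases h1 : μ = κ ∧ μ = κ'
  · obtain ⟨rfl, rfl⟩ := h1
    by_cases h2 : α = μ ∧ β = μ
    · obtain ⟨rfl, rfl⟩ := h2
      simp only [and_self, if_true]
      exact sum4_wsym22_eq_zero N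
    · simp [h2]
  · simp [h1]

/-- [folklore] a frame `(μ,ν)` not containing all four pattern directions carries no charge (any table `T`). -/
theorem frame_eq_zero_of_not_mem (T : Fin 4 → Fin 4 → Fin 4 → Fin 4 → ℝ) {μ ν κ κ' α β : Fin (d + 1)}
    (h : ¬((κ = μ ∨ κ = ν) ∧ (κ' = μ ∨ κ' = ν) ∧ (α = μ ∨ α = ν) ∧ (β = μ ∨ β = ν))) :
    (∑ k : Fin 4, ∑ l : Fin 4, if dir μ ν k = κ ∧ dir μ ν l = κ' then
        ∑ i : Fin 4, ∑ j : Fin 4, (if α = dir μ ν i ∧ β = dir μ ν j then T i j k l else 0) else 0) = 0 := by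
  refine Finset.sum_eq_zero fun k _ => Finset.sum_eq_zero fun l _ => ?_
  split_ifs with hk
  · refine Finset.sum_eq_zero fun i _ => Finset.sum_eq_zero fun j _ => ?_
    rw [if_neg]
    rintro ⟨hi, hj⟩
    have mem : ∀ (q : Fin 4) (x : Fin (d + 1)), dir μ ν q = x → x = μ ∨ x = ν := fun q x hq => by
      rcases dir_eq_or μ ν q with h0 | h0
      · exact Or.inl (hq.symm.trans h0)
      · exact Or.inr (hq.symm.trans h0)
    exact h ⟨mem k κ hk.1, mem l κ' hk.2, mem i α hi.symm, mem j β hj.symm⟩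
  · rfl

end Summit.QuantumFields.BalabanUV.Beta.GAN24.WilsonQuarticChargeWsym22Frames

end
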